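import Literature.NumberTheory.EllipticCurves.WeilPairingTateDual
import Literature.NumberTheory.EllipticCurves.LocalKummerIsotropyTransport
import Literature.NumberTheory.EllipticCurves.KummerImageIsotropyProofs
import HarnessLib

/-!
# Local Tate duality for `E[n]` through the Weil pairing, and maximal isotropy of the local Kummer condition

Topic `NumberTheory/EllipticCurves`; namespace `Literature.NumberTheory.EllipticCurves` (as the siblings
`KummerImageIsotropy.lean`, `WeilPairingTateDual.lean`). Definitions with bodies and theorems only:
**no named fact is introduced** (D-0026).

Let `K` be a number field, `E = W` an elliptic curve over `K`, `n ≠ 0`, `e` a non-degenerate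
`Γ_K`-equivariant biadditive `μₙ`-valued pairing on `E[n]` (a Weil pairing, `exists_weilPairing`), and
`F` a `K`-field which is a non-archimedean local field of characteristic `0` (a completion `K_v` at a
finite place).  On `H¹(F, E[n]) = H¹(Γ_F, E[n](K̄)|_{Γ_F})` there is the local Weil cup product
`x ∪ₑ y ∈ H²(Γ_F, μₙ(K̄)|_{Γ_F})` (the restriction of `weilContPairing W n e` to `Γ_F`; at a place this is
`weilContPairingLocal` of `WeilPairingTateDual.lean`).

* **Local Tate duality for the self-dual module `E[n]`** (Milne, *ADT*, I Cor. 2.3 with the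
  identification `A_m^D = A^t_m = A_m` through the `e_m`-pairing, I §6, proof of Prop. 6.9; Silverman,
  *AEC*, X.§4 / Tate): the local Weil cup product has **trivial left and right kernels** on the finite group
  `H¹(F, E[n])` (`eq_zero_of_forall_weilCupProduct_eq_zero`, `eq_zero_of_forall_weilCupProduct_eq_zero_right`).
  Proof: the tree's local duality theorem `localDuality_bijective` for the finite `Γ_F`-module
  `E[n](K̄)|_{Γ_F}` (perfectness of `(x, f) ↦ ι(x ∪_{ev} f)` on `H¹(F, E[n]) × H¹(F, Hom(E[n], μₙ(F̄)))`),
  transported along the **local Weil dual isomorphism** `E[n] ≅ Hom(E[n], μₙ(F̄))`, `T ↦ (S ↦ e(S, T))`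
  (`weilDualLocalHom`, bijective by non-degeneracy and counting, `weilDualLocalIso`) and
  `μₙ(K̄)|_{Γ_F} ≅ μₙ(F̄)` (`muRestrictIso`), using the covariant naturality of the cup product
  (`cohomologyMap_muRestrictIso_weilCupProduct`: `H²(μ-iso)(x ∪ₑ y) = x ∪_{ev} H¹(w)(y)`).
* **Maximal isotropy of the local Kummer condition** (the local input of Milne, *ADT*, I Lemma 6.15
  and of Thm. 6.13(a); Tate local duality for `A`, Milne I Cor. 3.4): the local Kummer condition
  `𝓛_F = kummerLocalConditionAt W n F` (image of `E(F)/n → H¹(F, E[n])`) is isotropic for `∪ₑ`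
  (tree: the discharged Poonen–Rains fact `kummerClass_cupProduct_kummerClass_eq_zero_holds`), hence
  it is **its own annihilator as soon as `#H¹(F, E[n]) ≤ (#𝓛_F)²`**
  (`forall_mem_kummerLocalConditionAt_weilCupProduct_eq_zero_iff`):
  `(∀ y ∈ 𝓛_F, x ∪ₑ y = 0) ↔ x ∈ 𝓛_F`.  The count hypothesis is Tate's local Euler characteristic
  formula `#H¹(K_v, E[n]) = #E(K_v)[n]² · #(𝓞_v/n)²` together with `#𝓛_v = #E(K_v)[n] · #(𝓞_v/n)`
  (Milne I Lemma 3.3, tree `card_quotient_range_nsmul_adicCompletion`); it is kept as a hypothesis here.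
* The pure counting lemma behind it: `forall_mem_apply_eq_zero_iff_of_isotropic_of_card_le` — for a
  `ℤ/n`-valued pairing `b : A × B → ℤ/n` of finite groups with injective left adjoint, `nB = 0`, and
  subgroups `L ≤ A`, `L' ≤ B` with `b(L, L') = 0` and `#B ≤ #L · #L'`, `L` is the annihilator of `L'`.
* At a finite place `v` of `K` (`F = K_v`, the local condition `W.kummerSelmerStructure n (Sum.inr v)`
  and the local Weil pairing `weilContPairingLocal … (Sum.inr v)`): `…_inr` versions.

Motivation: provefact `WeierstrassCurve.exists_casselsTate_pairing` (Silverman *AEC* X.4.14; Milne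
*ADT* I.6.9/6.13(a)), kernel direction.

## References

* [MilneADT2006] J. S. Milne, *Arithmetic Duality Theorems*, 2nd ed. (2006), Ch. I: Cor. 2.3,
  Lemma 3.3, Cor. 3.4, §6 (proof of Prop. 6.9, Lemma 6.15).
* [SilvermanAEC2009] J. H. Silverman, *The Arithmetic of Elliptic Curves*, 2nd ed. (2009), III.§8
  (Weil pairing, Prop. III.8.1), X.§4.
* [PoonenRains2012] B. Poonen, E. Rains, *Random maximal isotropic subspaces and Selmer groups*,
  J. Amer. Math. Soc. 25 (2012), Prop. 4.8, Cor. 4.6, Prop. 4.10 (the image of `A(k_v)/λ` is maximal isotropic).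
* [SerreGaloisCohomology1997] J.-P. Serre, *Galois Cohomology* (1997), II §5.2 Thm. 2.
-/

noncomputable section

open scoped Classical

universe u

namespace Literature.NumberTheory.EllipticCurves

open CategoryTheory WeierstrassCurve Field Function
open Literature.NumberTheory.GaloisRepresentations
open Literature.NumberTheory.GaloisRepresentations.DiscreteGaloisModule (mu MuCarrier)
open scoped ContRepresentation

/-! ## The counting lemma: an isotropic pair of subgroups of complementary size are annihilators -/

/-- **Annihilators by counting.** Let `b : A × B → ℤ/n` be a bi-additive pairing of finite abelian
groups with injective left adjoint, `nB = 0`, and let `L ≤ A`, `L' ≤ B` be subgroups with `b(L, L') = 0`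
and `#B ≤ #L · #L'`. Then `L` is exactly the annihilator of `L'`: for `x ∈ A`,
`(∀ y ∈ L', b x y = 0) ↔ x ∈ L`.  (The annihilator of `L'` embeds into `Hom(B/L', ℤ/n)`, of order
`#(B/L') = #B/#L' ≤ #L`.)  This is the counting step of "the image of `A(K_v)/n` is maximal isotropic"
(Milne, *ADT*, I Cor. 3.4 / proof of Lemma 6.15; Poonen–Rains 2012, proof of Prop. 4.10). [folklore] -/
theorem forall_mem_apply_eq_zero_iff_of_isotropic_of_card_le {A B : Type*} [AddCommGroup A]
    [AddCommGroup B] [Finite A] [Finite B] {n : ℕ} [NeZero n] (b : A →+ B →+ ZMod n)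
    (hB : ∀ y : B, n • y = 0) (hinj : Injective b) (L : AddSubgroup A) (L' : AddSubgroup B)
    (hiso : ∀ x ∈ L, ∀ y ∈ L', b x y = 0) (hcard : Nat.card B ≤ Nat.card L * Nat.card L') (x : A) :
    (∀ y ∈ L', b x y = 0) ↔ x ∈ L := by
  -- the annihilator of `L'`
  let ann : AddSubgroup A :=
    { carrier := {x | ∀ y ∈ L', b x y = 0}
      zero_mem' := fun y _ => by rw [map_zero, AddMonoidHom.zero_apply]
      add_mem' := fun {x x'} hx hx' y hy => by
        rw [map_add, AddMonoidHom.add_apply, hx y hy, hx' y hy, add_zero]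
      neg_mem' := fun {x} hx y hy => by rw [map_neg, AddMonoidHom.neg_apply, hx y hy, neg_zero] }
  have hL : L ≤ ann := fun x hx y hy => hiso x hx y hy
  -- `B ⧸ L'` is killed by `n`
  have hBq : ∀ z : B ⧸ L', n • z = 0 := fun z => by
    induction z using QuotientAddGroup.induction_on with
    | H y => rw [← QuotientAddGroup.mk_nsmul, hB, QuotientAddGroup.mk_zero]
  -- `ann ↪ Hom(B ⧸ L', ℤ/n)`, `x ↦ (ȳ ↦ b x y)`
  let φ : ann → (B ⧸ L' →+ ZMod n) := fun x =>
    QuotientAddGroup.lift L' (b x) fun y hy => (AddMonoidHom.mem_ker).mpr (x.2 y hy)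
  have hφ : Injective φ := by
    intro x x' h
    apply Subtype.ext
    apply hinj
    refine AddMonoidHom.ext fun y => ?_
    have h' := DFunLike.congr_fun h (y : B ⧸ L')
    rwa [QuotientAddGroup.lift_mk, QuotientAddGroup.lift_mk] at h'
  haveI : Finite (B ⧸ L' →+ ZMod n) := finite_addMonoidHom_zmod _ n
  have h1 : Nat.card ann ≤ Nat.card (B ⧸ L') :=
    (Nat.card_le_card_of_injective φ hφ).trans_eq (Nat.card_addMonoidHom_zmod hBq)
  have h3 : Nat.card ann ≤ Nat.card L := by
    refine Nat.le_of_mul_le_mul_right ?_ (Nat.card_pos (α := L'))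
    calc Nat.card ann * Nat.card L'
        ≤ Nat.card (B ⧸ L') * Nat.card L' := Nat.mul_le_mul_right _ h1
      _ = Nat.card B := (AddSubgroup.card_eq_card_quotient_mul_card_addSubgroup L').symm
      _ ≤ Nat.card L * Nat.card L' := hcard
  have heq : L = ann := AddSubgroup.eq_of_le_of_card_ge hL h3
  refine ⟨fun hx => ?_, fun hx y hy => hiso x hx y hy⟩
  rw [heq]
  exact hx

-- Cup products need `LocallyCompactSpace Γ_F`; as in `WeilPairingTateDual.lean`, the compactness of
-- absolute Galois groups is a local instance only.
attribute [local instance] absoluteGaloisGroup_compactSpace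

section LocalField

variable {K : Type u} [Field K] [CharZero K] (W : WeierstrassCurve K) (n : ℕ) [NeZero n] [W.IsElliptic]
variable (e : geomTorsion W n → geomTorsion W n → AlgebraicClosure K)
  (hμ : ∀ S T, e S T ^ n = 1)
  (hadd₁ : ∀ S₁ S₂ T, e (S₁ + S₂) T = e S₁ T * e S₂ T)
  (hadd₂ : ∀ S T₁ T₂, e S (T₁ + T₂) = e S T₁ * e S T₂)
variable (F : Type u) [Field F] [Algebra K F] [CharZero F]

attribute [local instance] finite_geomTorsion_of_neZero

/-! ## The local Weil dual map `E[n](K̄)|_{Γ_F} → Hom(E[n], μₙ(F̄))` -/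

/-- **The local Weil dual map** `E[n] → Hom(E[n], μₙ(F̄))`, `T ↦ (S ↦ ι e(S, T))`, where
`ι : μₙ(K̄) → μₙ(F̄)` is the transfer along the chosen embedding `K̄ → F̄` (`muTransfer`): the Weil
dual map `weilDualHom` of `WeilPairingTateDual.lean` read in the roots of unity of the local field.
Milne, *ADT*, I §6 (the `e_m`-pairing identifies `A_m` with `(A_m)^D`). [folklore] -/
def weilDualLocalHom : geomTorsion W n →+ HomCarrier (geomTorsion W n) (MuCarrier F n) :=
  AddMonoidHom.mk'
    (fun T => HomCarrier.ofAddMonoidHom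
      ((muTransfer K F n).comp ((weilPairingHom W n e hμ hadd₁ hadd₂).flip T)))
    fun T T' => HomCarrier.ext fun S => by
      rw [HomCarrier.add_apply, HomCarrier.ofAddMonoidHom_apply, HomCarrier.ofAddMonoidHom_apply,
        HomCarrier.ofAddMonoidHom_apply, AddMonoidHom.comp_apply, AddMonoidHom.comp_apply,
        AddMonoidHom.comp_apply, map_add, AddMonoidHom.add_apply, map_add]

omit [CharZero K] [W.IsElliptic] [CharZero F] in
/-- Unfolding `weilDualLocalHom`: `(w T)(S) = ι e(S, T)`. [folklore] -/
@[simp]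
theorem weilDualLocalHom_apply_apply (S T : geomTorsion W n) :
    weilDualLocalHom W n e hμ hadd₁ hadd₂ F T S =
      muTransfer K F n (weilPairingHom W n e hμ hadd₁ hadd₂ S T) :=
  rfl

omit [CharZero K] [CharZero F] in
/-- **The local Weil dual map is `Γ_F`-equivariant** from `E[n](K̄)|_{Γ_F}` (the restricted module
`GaloisRep.restrictField F (W.torsionGaloisModule n)`) to its `μₙ(F̄)`-dual
`Hom(E[n], μₙ(F̄))` (`ContinuousRep.homRep`): from `weilDualHom_smul` and the equivariance
`muTransfer_mu` of the transfer of roots of unity. [folklore] -/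
theorem weilDualLocalHom_smul (hgal : ∀ (σ : absoluteGaloisGroup K) (S T : geomTorsion W n), σ • e S T = e (σ • S) (σ • T))
    (σ : absoluteGaloisGroup F) (T : geomTorsion W n) :
    weilDualLocalHom W n e hμ hadd₁ hadd₂ F
        ((GaloisRep.restrictField F (W.torsionGaloisModule n)) σ T) =
      (ContinuousRep.homRep (GaloisRep.restrictField F (W.torsionGaloisModule n)) (mu F n)) σ
        (weilDualLocalHom W n e hμ hadd₁ hadd₂ F T) := by
  refine HomCarrier.ext fun S => ?_
  have hσ : ∀ (τ : absoluteGaloisGroup F) (P : geomTorsion W n),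
      (GaloisRep.restrictField F (W.torsionGaloisModule n)) τ P = absGaloisRestrict K F τ • P :=
    fun _ _ => rfl
  rw [ContinuousRep.homRep_apply_apply_apply, weilDualLocalHom_apply_apply,
    weilDualLocalHom_apply_apply, hσ, hσ, map_inv (absGaloisRestrict K F) σ, ← muTransfer_mu]
  congr 1
  -- `e(S, σT) = σ e(σ⁻¹ S, T)` in `μₙ(K̄)` (Galois equivariance of `e`)
  apply MuCarrier.toAdditive.injective
  rw [DiscreteGaloisModule.mu_apply_apply]
  apply Additive.toMul.injective
  apply Subtype.ext
  apply Units.ext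
  rw [toMul_ofMul, absoluteGaloisGroup.coe_smul_rootsOfUnity, Units.coe_smul, coe_weilPairingHom,
    coe_weilPairingHom, hgal, smul_inv_smul]

omit [CharZero K] [CharZero F] [W.IsElliptic] in
/-- The local Weil dual map is injective for `e` non-degenerate on the right
(`weilDualHom_injective` and the injectivity of `μₙ(K̄) → μₙ(F̄)`). Silverman, *AEC*, III.8.1 (c).
[folklore] -/
theorem weilDualLocalHom_injective (hnondeg : ∀ T, (∀ S, e S T = 1) → T = 0) :
    Injective (weilDualLocalHom W n e hμ hadd₁ hadd₂ F) := by
  refine (injective_iff_map_eq_zero _).mpr fun T hT => hnondeg T fun S => ?_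
  have h : muTransfer K F n (weilPairingHom W n e hμ hadd₁ hadd₂ S T) = 0 := by
    have h' := congrArg (fun f : HomCarrier (geomTorsion W n) (MuCarrier F n) => f S) hT
    simpa only [weilDualLocalHom_apply_apply, HomCarrier.zero_apply] using h'
  have h' : weilPairingHom W n e hμ hadd₁ hadd₂ S T = 0 :=
    muTransfer_injective K F n (h.trans (map_zero _).symm)
  rw [muCarrier_eq_iff, coe_weilPairingHom] at h'
  exact h'

/-- `μₙ(F̄)` is finite (of order `n`, tree `natCard_muCarrier`); a local instance in this file. [folklore] -/
theorem finite_muCarrier (n : ℕ) [NeZero n] (F : Type u) [Field F] [CharZero F] : Finite (MuCarrier F n) :=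
  Nat.finite_of_card_ne_zero (by rw [natCard_muCarrier]; exact NeZero.ne n)

attribute [local instance] finite_muCarrier

omit [CharZero K] in
/-- **The local Weil dual map is bijective** for `e` non-degenerate: injective, and
`#Hom(E[n], μₙ(F̄)) = #E[n]` (`HomCarrier.natCard_eq` with `μₙ(F̄) ≃ ℤ/n`, `muEquivZMod`).
Silverman, *AEC*, III.8.1; Milne, *ADT*, I §0 (`M^DD = M`). [folklore] -/
theorem weilDualLocalHom_bijective (hnondeg : ∀ T, (∀ S, e S T = 1) → T = 0) :
    Bijective (weilDualLocalHom W n e hμ hadd₁ hadd₂ F) :=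
  (weilDualLocalHom_injective W n e hμ hadd₁ hadd₂ F hnondeg).bijective_of_nat_card_le
    (HomCarrier.natCard_eq (muEquivZMod F n) (fun T : geomTorsion W n =>
      AddSubgroup.torsionBy.nsmul T)).le

/-- **`E[n](K̄)|_{Γ_F} ≅ Hom(E[n], μₙ(F̄))` as discrete `Γ_F`-modules** (the local Weil dual map,
bijective and equivariant; tree constructor `topRepIsoOfEquiv`). Milne, *ADT*, I §6, proof of
Prop. 6.9 (`A_m^D = A^t_m`, identified with `A_m` by the `e_m`-pairing for an elliptic curve). [folklore] -/
def weilDualLocalIso (hgal : ∀ (σ : absoluteGaloisGroup K) (S T : geomTorsion W n), σ • e S T = e (σ • S) (σ • T))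
    (hnondeg : ∀ T, (∀ S, e S T = 1) → T = 0) :
    TopRep.res (absGaloisRestrict K F : absoluteGaloisGroup F →* absoluteGaloisGroup K)
        (W.torsionGaloisModule n).toTopRep ≅
      (ContinuousRep.homRep (GaloisRep.restrictField F (W.torsionGaloisModule n)) (mu F n)).toTopRep :=
  topRepIsoOfEquiv
    (X := TopRep.res (absGaloisRestrict K F : absoluteGaloisGroup F →* absoluteGaloisGroup K)
      (W.torsionGaloisModule n).toTopRep)
    (Y := (ContinuousRep.homRep (GaloisRep.restrictField F (W.torsionGaloisModule n)) (mu F n)).toTopRep)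
    { (AddEquiv.ofBijective _
        (weilDualLocalHom_bijective W n e hμ hadd₁ hadd₂ F hnondeg)).toIntLinearEquiv with
      continuous_toFun := continuous_of_discreteTopology
      continuous_invFun := continuous_of_discreteTopology }
    fun σ T => weilDualLocalHom_smul W n e hμ hadd₁ hadd₂ F hgal σ T

omit [CharZero K] in
/-- Unfolding `weilDualLocalIso`: its `hom` is the local Weil dual map. [folklore] -/
@[simp]
theorem weilDualLocalIso_hom_apply (hgal : ∀ (σ : absoluteGaloisGroup K) (S T : geomTorsion W n), σ • e S T = e (σ • S) (σ • T))
    (hnondeg : ∀ T, (∀ S, e S T = 1) → T = 0) (T : geomTorsion W n) :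
    (weilDualLocalIso W n e hμ hadd₁ hadd₂ F hgal hnondeg).hom.hom T =
      weilDualLocalHom W n e hμ hadd₁ hadd₂ F T :=
  rfl

/-! ## `μₙ(K̄)|_{Γ_F} ≅ μₙ(F̄)` -/

variable (K) in
/-- **`μₙ(K̄)|_{Γ_F} ≅ μₙ(F̄)`** as discrete `Γ_F`-modules, for any `K`-field `F` of characteristic `0`
(the tree's transfer `muTransferEquiv K F n`, equivariant by `muTransfer_mu`; the case `F = K_v` is
the tree's `muLocalIso`). [folklore] -/
def muRestrictIso :
    TopRep.res (absGaloisRestrict K F : absoluteGaloisGroup F →* absoluteGaloisGroup K) (mu K n).toTopRep ≅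
      (mu F n).toTopRep :=
  topRepIsoOfEquiv
    (X := TopRep.res (absGaloisRestrict K F : absoluteGaloisGroup F →* absoluteGaloisGroup K) (mu K n).toTopRep)
    (Y := (mu F n).toTopRep)
    { (muTransferEquiv K F n).toIntLinearEquiv with
      continuous_toFun := continuous_of_discreteTopology
      continuous_invFun := continuous_of_discreteTopology }
    fun σ x => muTransfer_mu K F n σ x

/-! ## The local Weil cup product is the evaluation cup product after the Weil dual map -/

/-- **`H²(μ-iso)(x ∪ₑ y) = x ∪_{ev} H¹(w)(y)`**: the local Weil cup product `x ∪ₑ y ∈ H²(Γ_F, μₙ(K̄))`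
of `x, y ∈ H¹(F, E[n])` (restriction of `weilContPairing` to `Γ_F`), carried to `H²(Γ_F, μₙ(F̄))`,
is the evaluation cup product (`ContinuousRep.evalPairing`, the pairing of the tree's local duality
theorem) of `x` with the image of `y` under the local Weil dual isomorphism (covariant naturality of
the cup product, `ContPairing.cupProduct_map`). Milne, *ADT*, I §6, proof of Prop. 6.9 ("the
cup-product induced by the `e_m`-pairing"). [folklore] -/
theorem cohomologyMap_muRestrictIso_weilCupProduct (hgal : ∀ (σ : absoluteGaloisGroup K) (S T : geomTorsion W n), σ • e S T = e (σ • S) (σ • T))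
    (hnondeg : ∀ T, (∀ S, e S T = 1) → T = 0)
    (x y : galoisCohomology (GaloisRep.restrictField F (W.torsionGaloisModule n)) 1) :
    cohomologyMap (muRestrictIso K n F).hom 2
        (((weilContPairing W n e hμ hadd₁ hadd₂ hgal).restrict (absGaloisRestrict K F)).cupProduct x y) =
      ((GaloisRep.restrictField F (W.torsionGaloisModule n)).evalPairing (mu F n)).cupProduct x
        (cohomologyMap (weilDualLocalIso W n e hμ hadd₁ hadd₂ F hgal hnondeg).hom 1 y) := by
  refine (ContPairing.cupProduct_map
    ((weilContPairing W n e hμ hadd₁ hadd₂ hgal).restrict (absGaloisRestrict K F))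
    ((GaloisRep.restrictField F (W.torsionGaloisModule n)).evalPairing (mu F n)) (𝟙 _)
    (weilDualLocalIso W n e hμ hadd₁ hadd₂ F hgal hnondeg).hom (muRestrictIso K n F).hom
    (fun _ _ => rfl) x y).trans ?_
  exact congrArg (fun z => ((GaloisRep.restrictField F (W.torsionGaloisModule n)).evalPairing
      (mu F n)).cupProduct z (cohomologyMap (weilDualLocalIso W n e hμ hadd₁ hadd₂ F hgal hnondeg).hom 1 y))
    (map_apply_of_id _ (fun _ => rfl) _ (fun _ => rfl) 1 x)

/-! ## Local Tate duality for `E[n]` through the Weil pairing -/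

variable [ValuativeRel F] [TopologicalSpace F] [IsNonarchimedeanLocalField F]

omit [CharZero K] in
/-- **`H¹(F, E[n])` is finite** for the local field `F` (tree
`finite_galoisCohomology_one_of_isNonarchimedeanLocalField`). Milne, *ADT*, I Cor. 2.3; Serre,
*Galois Cohomology*, II §5.2 Prop. 14. [cite: MilneADT2006, Ch. I, Cor. 2.3] -/
theorem finite_galoisCohomology_one_torsion_restrictField :
    Finite (galoisCohomology (GaloisRep.restrictField F (W.torsionGaloisModule n)) 1) :=
  finite_galoisCohomology_one_of_isNonarchimedeanLocalField _

/-- **Local Tate duality for `E[n]`, left kernel**: if `x ∪ₑ y = 0` in `H²(Γ_F, μₙ)` for all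
`y ∈ H¹(F, E[n])`, then `x = 0` — the cup product of the Weil pairing is a non-degenerate pairing of
the finite group `H¹(F, E[n])` with itself (Milne, *ADT*, I Cor. 2.3 for `M = E[n]`, `M^D ≅ E[n]` by
the Weil pairing; Tate). From the tree's `localDuality_bijective` along `weilDualLocalIso`,
`muRestrictIso`. [cite: MilneADT2006, Ch. I, Cor. 2.3] -/
theorem eq_zero_of_forall_weilCupProduct_eq_zero (hgal : ∀ (σ : absoluteGaloisGroup K) (S T : geomTorsion W n), σ • e S T = e (σ • S) (σ • T))
    (hnondeg : ∀ T, (∀ S, e S T = 1) → T = 0)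
    (x : galoisCohomology (GaloisRep.restrictField F (W.torsionGaloisModule n)) 1)
    (hx : ∀ y, ((weilContPairing W n e hμ hadd₁ hadd₂ hgal).restrict
      (absGaloisRestrict K F)).cupProduct x y = 0) :
    x = 0 := by
  obtain ⟨ι, -, hb, -⟩ := localDuality_bijective F
    (GaloisRep.restrictField F (W.torsionGaloisModule n) :
      ContinuousRep (absoluteGaloisGroup F) ℤ (geomTorsion W n))
    (fun T : geomTorsion W n => AddSubgroup.torsionBy.nsmul T)
  have h0 : (GaloisRep.restrictField F (W.torsionGaloisModule n)).dualityPairing (mu F n) ι x = 0 := by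
    refine AddMonoidHom.ext fun y' => ?_
    obtain ⟨y, hy'⟩ :=
      (continuousCohomologyEquivOfIso (weilDualLocalIso W n e hμ hadd₁ hadd₂ F hgal hnondeg) 1).surjective y'
    rw [ContinuousRep.dualityPairing_apply, AddMonoidHom.zero_apply, ← hy']
    change ι (((GaloisRep.restrictField F (W.torsionGaloisModule n)).evalPairing (mu F n)).cupProduct x
      (cohomologyMap (weilDualLocalIso W n e hμ hadd₁ hadd₂ F hgal hnondeg).hom 1 y)) = 0
    rw [← cohomologyMap_muRestrictIso_weilCupProduct W n e hμ hadd₁ hadd₂ F hgal hnondeg, hx y, map_zero,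
      map_zero]
  exact hb.1 (h0.trans (map_zero _).symm)

/-- **Local Tate duality for `E[n]`, right kernel**: if `x ∪ₑ y = 0` for all `x ∈ H¹(F, E[n])`, then
`y = 0`. [cite: MilneADT2006, Ch. I, Cor. 2.3] -/
theorem eq_zero_of_forall_weilCupProduct_eq_zero_right (hgal : ∀ (σ : absoluteGaloisGroup K) (S T : geomTorsion W n), σ • e S T = e (σ • S) (σ • T))
    (hnondeg : ∀ T, (∀ S, e S T = 1) → T = 0)
    (y : galoisCohomology (GaloisRep.restrictField F (W.torsionGaloisModule n)) 1)
    (hy : ∀ x, ((weilContPairing W n e hμ hadd₁ hadd₂ hgal).restrict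
      (absGaloisRestrict K F)).cupProduct x y = 0) :
    y = 0 := by
  obtain ⟨ι, -, -, hbf⟩ := localDuality_bijective F
    (GaloisRep.restrictField F (W.torsionGaloisModule n) :
      ContinuousRep (absoluteGaloisGroup F) ℤ (geomTorsion W n))
    (fun T : geomTorsion W n => AddSubgroup.torsionBy.nsmul T)
  have h0 : ((GaloisRep.restrictField F (W.torsionGaloisModule n)).dualityPairing (mu F n) ι).flip
      (cohomologyMap (weilDualLocalIso W n e hμ hadd₁ hadd₂ F hgal hnondeg).hom 1 y) = 0 := by
    refine AddMonoidHom.ext fun x => ?_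
    rw [AddMonoidHom.flip_apply, ContinuousRep.dualityPairing_apply, AddMonoidHom.zero_apply,
      ← cohomologyMap_muRestrictIso_weilCupProduct, hy x, map_zero, map_zero]
  have h1 : cohomologyMap (weilDualLocalIso W n e hμ hadd₁ hadd₂ F hgal hnondeg).hom 1 y = 0 :=
    hbf.1 (h0.trans (map_zero _).symm)
  have h2 : cohomologyMap (weilDualLocalIso W n e hμ hadd₁ hadd₂ F hgal hnondeg).hom 1 y =
      cohomologyMap (weilDualLocalIso W n e hμ hadd₁ hadd₂ F hgal hnondeg).hom 1 0 := by
    rw [h1, map_zero]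
  exact (continuousCohomologyEquivOfIso (weilDualLocalIso W n e hμ hadd₁ hadd₂ F hgal hnondeg) 1).injective h2

/-! ## Maximal isotropy of the local Kummer condition -/

/-- **The local Kummer condition is its own annihilator, given the Euler-characteristic count.**
For `e` alternating and non-degenerate and `F` a `K`-field which is a non-archimedean local field of
characteristic `0`: if `#H¹(F, E[n]) ≤ (#𝓛_F)²` (`𝓛_F = kummerLocalConditionAt W n F`, the image of
`E(F)/n`; the inequality is Tate's local Euler characteristic formula combined with Milne I Lemma 3.3),
then for `x ∈ H¹(F, E[n])`,

  `(∀ y ∈ 𝓛_F, x ∪ₑ y = 0) ↔ x ∈ 𝓛_F`.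

Isotropy (`←`) is the discharged Poonen–Rains fact (`kummerClass_cupProduct_kummerClass_eq_zero_holds`,
transported by `cupProduct_eq_zero_of_mem_kummerLocalConditionAt_of_fact`); maximality (`→`) is local
Tate duality for `E[n]` (`eq_zero_of_forall_weilCupProduct_eq_zero`) and the counting lemma
`forall_mem_apply_eq_zero_iff_of_isotropic_of_card_le`. This is "the image of `E(K_v)` in
`H¹(K_v, E[n])` is the exact annihilator of itself" — Tate local duality for `E` (Milne, *ADT*, I Cor. 3.4)
read on `H¹(K_v, E[n])`, the local input of Milne I Lemma 6.15; Poonen–Rains 2012, Prop. 4.10 ("`W ≅ Â(k_v)/λA(k_v)` is a compact open maximal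
isotropic subgroup of `H¹(k_v, A[λ])`", proved there from Tate local duality, Milne I.3.4/3.7).
[cite: MilneADT2006, Ch. I, Cor. 3.4 and Lemma 6.15] [cite: PoonenRains2012, Prop. 4.10] -/
theorem forall_mem_kummerLocalConditionAt_weilCupProduct_eq_zero_iff (hgal : ∀ (σ : absoluteGaloisGroup K) (S T : geomTorsion W n), σ • e S T = e (σ • S) (σ • T))
    (halt : ∀ T, e T T = 1)
    (hnondeg : ∀ T, (∀ S, e S T = 1) → T = 0)
    (hcard : Nat.card (galoisCohomology (GaloisRep.restrictField F (W.torsionGaloisModule n)) 1) ≤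
      Nat.card (W.kummerLocalConditionAt n F) * Nat.card (W.kummerLocalConditionAt n F))
    (x : galoisCohomology (GaloisRep.restrictField F (W.torsionGaloisModule n)) 1) :
    (∀ y ∈ W.kummerLocalConditionAt n F, ((weilContPairing W n e hμ hadd₁ hadd₂ hgal).restrict
      (absGaloisRestrict K F)).cupProduct x y = 0) ↔ x ∈ W.kummerLocalConditionAt n F := by
  have hnZ : (n : ℤ) ≠ 0 := Int.natCast_ne_zero.mpr (NeZero.ne n)
  haveI := finite_galoisCohomology_one_torsion_restrictField W n F
  -- isotropy of `𝓛_F` (the discharged Poonen–Rains fact over `F`)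
  have hiso : ∀ x ∈ W.kummerLocalConditionAt n F, ∀ y ∈ W.kummerLocalConditionAt n F,
      ((weilContPairing W n e hμ hadd₁ hadd₂ hgal).restrict (absGaloisRestrict K F)).cupProduct x y = 0 :=
    fun x hx y hy => W.cupProduct_eq_zero_of_mem_kummerLocalConditionAt_of_fact n e hnZ
      (kummerClass_cupProduct_kummerClass_eq_zero_holds F) hμ hadd₁ hadd₂ halt hgal hx hy
  refine ⟨fun hx => ?_, fun hx y hy => hiso x hx y hy⟩
  -- a `ℤ/n`-valued perfect pairing `b(x, y) = ι(H²(μ-iso)(x ∪ₑ y))` refining the cup product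
  obtain ⟨ι, hι, -, -⟩ := localDuality_bijective F
    (GaloisRep.restrictField F (W.torsionGaloisModule n) :
      ContinuousRep (absoluteGaloisGroup F) ℤ (geomTorsion W n))
    (fun T : geomTorsion W n => AddSubgroup.torsionBy.nsmul T)
  let inv : galoisCohomology (GaloisRep.restrictField F (mu K n)) 2 →+ ZMod n :=
    ι.comp (cohomologyMap (muRestrictIso K n F).hom 2).hom.toLinearMap.toAddMonoidHom
  have hinv : Injective inv :=
    hι.comp (continuousCohomologyEquivOfIso (muRestrictIso K n F) 2).injective
  let P := (weilContPairing W n e hμ hadd₁ hadd₂ hgal).restrict (absGaloisRestrict K F)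
  let b : galoisCohomology (GaloisRep.restrictField F (W.torsionGaloisModule n)) 1 →+
      galoisCohomology (GaloisRep.restrictField F (W.torsionGaloisModule n)) 1 →+ ZMod n :=
    AddMonoidHom.mk' (fun x => inv.comp (P.cupProduct x).toAddMonoidHom)
      fun x x' => AddMonoidHom.ext fun y => by
        change inv (P.cupProduct (x + x') y) = inv (P.cupProduct x y) + inv (P.cupProduct x' y)
        exact (congrArg inv (DFunLike.congr_fun (map_add P.cupProduct x x') y)).trans (map_add inv _ _)
  have hb : ∀ x y, b x y = inv (P.cupProduct x y) := fun _ _ => rfl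
  have hbinj : Injective b := by
    refine (injective_iff_map_eq_zero _).mpr fun x hx => ?_
    refine eq_zero_of_forall_weilCupProduct_eq_zero W n e hμ hadd₁ hadd₂ F hgal hnondeg x fun y => ?_
    have h1 : inv (P.cupProduct x y) = 0 := by rw [← hb, hx, AddMonoidHom.zero_apply]
    exact hinv (h1.trans (map_zero inv).symm)
  have hH : ∀ y : galoisCohomology (GaloisRep.restrictField F (W.torsionGaloisModule n)) 1, n • y = 0 :=
    nsmul_continuousCohomology_one_eq_zero _ n (fun T : geomTorsion W n => AddSubgroup.torsionBy.nsmul T)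
  refine (forall_mem_apply_eq_zero_iff_of_isotropic_of_card_le b hH hbinj (W.kummerLocalConditionAt n F)
    (W.kummerLocalConditionAt n F)
    (fun x hx y hy => (hb x y).trans ((congrArg inv (hiso x hx y hy)).trans (map_zero inv))) hcard x).mp
    fun y hy => (hb _ y).trans ((congrArg inv (hx y hy)).trans (map_zero inv))

/-- The same maximality for the pairing `(x, y) ↦ inv(x ∪ₑ y)` with ANY additive `inv` on
`H²(Γ_F, μₙ)` which is injective (e.g. the invariant map of local class field theory):
`(∀ y ∈ 𝓛_F, inv(x ∪ₑ y) = 0) ↔ x ∈ 𝓛_F`. [cite: MilneADT2006, Ch. I, Cor. 3.4 and Lemma 6.15] -/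
theorem forall_mem_kummerLocalConditionAt_inv_weilCupProduct_eq_zero_iff (hgal : ∀ (σ : absoluteGaloisGroup K) (S T : geomTorsion W n), σ • e S T = e (σ • S) (σ • T))
    (halt : ∀ T, e T T = 1)
    (hnondeg : ∀ T, (∀ S, e S T = 1) → T = 0)
    (hcard : Nat.card (galoisCohomology (GaloisRep.restrictField F (W.torsionGaloisModule n)) 1) ≤
      Nat.card (W.kummerLocalConditionAt n F) * Nat.card (W.kummerLocalConditionAt n F))
    {T : Type*} [AddCommGroup T] (inv : galoisCohomology (GaloisRep.restrictField F (mu K n)) 2 →+ T)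
    (hinv : Injective inv)
    (x : galoisCohomology (GaloisRep.restrictField F (W.torsionGaloisModule n)) 1) :
    (∀ y ∈ W.kummerLocalConditionAt n F, inv (((weilContPairing W n e hμ hadd₁ hadd₂ hgal).restrict
      (absGaloisRestrict K F)).cupProduct x y) = 0) ↔ x ∈ W.kummerLocalConditionAt n F := by
  rw [← forall_mem_kummerLocalConditionAt_weilCupProduct_eq_zero_iff W n e hμ hadd₁ hadd₂ F hgal halt
    hnondeg hcard x]
  exact forall₂_congr fun y _ =>
    ⟨fun h => hinv (h.trans (map_zero inv).symm), fun h => (congrArg inv h).trans (map_zero inv)⟩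

end LocalField

/-! ## At a finite place of a number field -/

section NumberField

open NumberField IsDedekindDomain

variable {K : Type u} [Field K] [NumberField K] (W : WeierstrassCurve K) (n : ℕ) [NeZero n]
  [W.IsElliptic]
variable (e : geomTorsion W n → geomTorsion W n → AlgebraicClosure K)
  (hμ : ∀ S T, e S T ^ n = 1)
  (hadd₁ : ∀ S₁ S₂ T, e (S₁ + S₂) T = e S₁ T * e S₂ T)
  (hadd₂ : ∀ S T₁ T₂, e S (T₁ + T₂) = e S T₁ * e S T₂)
variable (v : HeightOneSpectrum (𝓞 K))

/-- **Local Tate duality for `E[n]` at a finite place `v`**, left kernel: for the local Weil pairing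
`weilContPairingLocal … (Sum.inr v)` on `H¹(K_v, E[n])`, `(∀ y, x ∪ₑ y = 0) → x = 0`.
[cite: MilneADT2006, Ch. I, Cor. 2.3] -/
theorem eq_zero_of_forall_weilCupProduct_eq_zero_inr (hgal : ∀ (σ : absoluteGaloisGroup K) (S T : geomTorsion W n), σ • e S T = e (σ • S) (σ • T))
    (hnondeg : ∀ T, (∀ S, e S T = 1) → T = 0)
    (x : galoisCohomology ((W.torsionGaloisModule n).toLocal (Sum.inr v)) 1)
    (hx : ∀ y, (weilContPairingLocal W n e hμ hadd₁ hadd₂ hgal (Sum.inr v)).cupProduct x y = 0) :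
    x = 0 := by
  haveI : CharZero (v.adicCompletion K) := charZero_adicCompletion v
  have h := eq_zero_of_forall_weilCupProduct_eq_zero W n e hμ hadd₁ hadd₂ (v.adicCompletion K) hgal hnondeg
  exact h x hx

/-- **Local Tate duality for `E[n]` at a finite place `v`**, right kernel.
[cite: MilneADT2006, Ch. I, Cor. 2.3] -/
theorem eq_zero_of_forall_weilCupProduct_eq_zero_right_inr (hgal : ∀ (σ : absoluteGaloisGroup K) (S T : geomTorsion W n), σ • e S T = e (σ • S) (σ • T))
    (hnondeg : ∀ T, (∀ S, e S T = 1) → T = 0)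
    (y : galoisCohomology ((W.torsionGaloisModule n).toLocal (Sum.inr v)) 1)
    (hy : ∀ x, (weilContPairingLocal W n e hμ hadd₁ hadd₂ hgal (Sum.inr v)).cupProduct x y = 0) :
    y = 0 := by
  haveI : CharZero (v.adicCompletion K) := charZero_adicCompletion v
  have h := eq_zero_of_forall_weilCupProduct_eq_zero_right W n e hμ hadd₁ hadd₂ (v.adicCompletion K) hgal
    hnondeg
  exact h y hy

/-- **Maximal isotropy of the local condition of the Kummer Selmer structure at a finite place `v`**,
given the Euler-characteristic count `#H¹(K_v, E[n]) ≤ (#𝓛_v)²`: for `x ∈ H¹(K_v, E[n])`,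
`(∀ y ∈ 𝓛_v, x ∪ₑ y = 0) ↔ x ∈ 𝓛_v` (`𝓛_v = W.kummerSelmerStructure n (Sum.inr v)`). Milne, *ADT*,
I Cor. 3.4 and Lemma 6.15; Poonen–Rains 2012, Prop. 4.10. [cite: MilneADT2006, Ch. I, Cor. 3.4 and Lemma 6.15] -/
theorem forall_mem_kummerSelmerStructure_weilCupProduct_eq_zero_iff_inr (hgal : ∀ (σ : absoluteGaloisGroup K) (S T : geomTorsion W n), σ • e S T = e (σ • S) (σ • T))
    (halt : ∀ T, e T T = 1)
    (hnondeg : ∀ T, (∀ S, e S T = 1) → T = 0)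
    (hcard : Nat.card (galoisCohomology ((W.torsionGaloisModule n).toLocal (Sum.inr v)) 1) ≤
      Nat.card (W.kummerSelmerStructure n (Sum.inr v)) *
        Nat.card (W.kummerSelmerStructure n (Sum.inr v)))
    (x : galoisCohomology ((W.torsionGaloisModule n).toLocal (Sum.inr v)) 1) :
    (∀ y ∈ W.kummerSelmerStructure n (Sum.inr v),
        (weilContPairingLocal W n e hμ hadd₁ hadd₂ hgal (Sum.inr v)).cupProduct x y = 0) ↔
      x ∈ W.kummerSelmerStructure n (Sum.inr v) := by
  haveI : CharZero (v.adicCompletion K) := charZero_adicCompletion v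
  have h := forall_mem_kummerLocalConditionAt_weilCupProduct_eq_zero_iff W n e hμ hadd₁ hadd₂
    (v.adicCompletion K) hgal halt hnondeg
  exact h hcard x

end NumberField

end Literature.NumberTheory.EllipticCurves

end
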